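import Summits.MatrixMultiplication.MatrixMultiplication.Theorems.NilpotentLieHostsUnitriangularCostShapeModelSubst

/-!
# `UnitriangularCostShape` — Product model, part 2: weights and the truncation ideal

Crux `stmt-MatrixMultiplication-7724` (`NilpotentLieHosts.UnitriangularCostShape`), line `registered`
(`Cruxes/UnitriangularCostShape/Lines/birth.lean`), stub `stub_productModel` (the Weyl-type product model of
`U(u_d)/I^(s+1)` over the truncated Casimir algebra, `b = k = ⌊d/2⌋`).  Helper vocabulary and lemmas, namespace
`…Theorems.UnitriangularCostShape.ProductModel`.

Weight lower bounds (`WtGe`), the truncation ideal `I_T` (monomials of weight `> T`), its stability under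
`sigma c`, the truncated module `W_T = R[Var d]/I_T`, `sigmaQ`, and nilpotency of positive-weight elements.
-/

set_option linter.dupNamespace false

noncomputable section

namespace Summit.MatrixMultiplication.MatrixMultiplication.Theorems.UnitriangularCostShape.ProductModel

open MvPolynomial
open scoped BigOperators

variable {d : ℕ} {R : Type*} [CommRing R]

/-- All monomials of `f` have weight `≥ a`. -/
def WtGe (a : ℕ) (f : MvPolynomial (Var d) R) : Prop :=
  ∀ m ∈ f.support, a ≤ Finsupp.weight Var.wt m

/-- Every polynomial has all weights `≥ 0`. -/
theorem wtGe_zero_left (f : MvPolynomial (Var d) R) : WtGe 0 f := fun _ _ => Nat.zero_le _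

/-- Monotonicity of the weight lower bound. -/
theorem WtGe.mono {a b : ℕ} (h : a ≤ b) {f : MvPolynomial (Var d) R} (hf : WtGe b f) : WtGe a f :=
  fun m hm => h.trans (hf m hm)

/-- Sums preserve weight lower bounds. -/
theorem WtGe.add {a : ℕ} {f g : MvPolynomial (Var d) R} (hf : WtGe a f) (hg : WtGe a g) :
    WtGe a (f + g) := by
  intro m hm
  classical
  have := MvPolynomial.support_add hm
  rcases Finset.mem_union.mp this with h | h
  · exact hf m h
  · exact hg m h

/-- Finite sums preserve weight lower bounds. -/
theorem WtGe.sum {ι : Type*} (s : Finset ι) {a : ℕ} {f : ι → MvPolynomial (Var d) R}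
    (hf : ∀ i ∈ s, WtGe a (f i)) : WtGe a (∑ i ∈ s, f i) := by
  classical
  induction s using Finset.induction_on with
  | empty => intro m hm; simp at hm
  | insert i s hi ih =>
    rw [Finset.sum_insert hi]
    exact (hf i (Finset.mem_insert_self i s)).add (ih fun j hj => hf j (Finset.mem_insert_of_mem hj))

/-- Weight lower bounds add under products. -/
theorem WtGe.mul {a b : ℕ} {f g : MvPolynomial (Var d) R} (hf : WtGe a f) (hg : WtGe b g) :
    WtGe (a + b) (f * g) := by
  classical
  intro m hm
  have := MvPolynomial.support_mul f g hm
  obtain ⟨m1, hm1, m2, hm2, rfl⟩ := Finset.mem_add.mp this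
  rw [map_add]
  exact Nat.add_le_add (hf m1 hm1) (hg m2 hm2)

/-- Weight lower bounds of powers. -/
theorem WtGe.pow {a : ℕ} {f : MvPolynomial (Var d) R} (hf : WtGe a f) (n : ℕ) :
    WtGe (n * a) (f ^ n) := by
  induction n with
  | zero => simpa using wtGe_zero_left (1 : MvPolynomial (Var d) R)
  | succ n ih =>
    rw [pow_succ, Nat.succ_mul]
    exact ih.mul hf

/-- Weight lower bounds of finite products. -/
theorem WtGe.prod {ι : Type*} (s : Finset ι) {a : ι → ℕ} {f : ι → MvPolynomial (Var d) R}
    (hf : ∀ i ∈ s, WtGe (a i) (f i)) : WtGe (∑ i ∈ s, a i) (∏ i ∈ s, f i) := by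
  classical
  induction s using Finset.induction_on with
  | empty => simpa using wtGe_zero_left (1 : MvPolynomial (Var d) R)
  | insert i s hi ih =>
    rw [Finset.sum_insert hi, Finset.prod_insert hi]
    exact (hf i (Finset.mem_insert_self i s)).mul (ih fun j hj => hf j (Finset.mem_insert_of_mem hj))

/-- Scaling by a constant preserves weight lower bounds. -/
theorem WtGe.C_mul {a : ℕ} {f : MvPolynomial (Var d) R} (hf : WtGe a f) (r : R) :
    WtGe a (C r * f) := by
  simpa using (wtGe_zero_left (C r : MvPolynomial (Var d) R)).mul hf

/-- A monomial has weight at least its own weight. -/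
theorem wtGe_monomial (m : Var d →₀ ℕ) (r : R) :
    WtGe (Finsupp.weight Var.wt m) (monomial m r) := by
  classical
  intro m' hm'
  have : m' = m := by
    by_contra h
    have := MvPolynomial.support_monomial_subset hm'
    simp [h] at this
  subst this; exact le_rfl

/-- A variable has weight at least its own weight. -/
theorem wtGe_X (u : Var d) : WtGe (R := R) u.wt (X u) := by
  have := wtGe_monomial (R := R) (Finsupp.single u 1) 1
  simp only [Finsupp.weight_apply, Finsupp.sum_single_index, zero_smul, one_smul] at this
  exact this

/-- The weight is monotone in the exponent vector. -/
theorem weight_le_of_le {m m' : Var d →₀ ℕ} (h : m' ≤ m) :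
    Finsupp.weight Var.wt m' ≤ Finsupp.weight Var.wt m := by
  obtain ⟨c, rfl⟩ := exists_add_of_le h
  rw [map_add]; exact Nat.le_add_right _ _

/-- `σ_c` does not lower weights: `σ_c (X u)` has all monomials of weight `≥ wt u`. -/
theorem wtGe_sigmaX (c : Matrix (Fin d) (Fin d) R) (u : Var d) : WtGe u.wt (sigmaX c u) := by
  classical
  unfold sigmaX
  refine (wtGe_X u).add (WtGe.sum _ fun u' _ => ?_)
  by_cases h : u'.col = u.col ∧ u'.row < u.row
  · rw [if_pos h]
    refine ((wtGe_X u').C_mul _).mono ?_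
    unfold Var.wt
    have h1 : (u'.row : ℕ) < u.row := h.2
    have h2 : (u'.col : ℕ) = u.col := by rw [h.1]
    have := u.row_lt_col
    have h3 : (u.row : ℕ) < u.col := this
    omega
  · rw [if_neg h]; intro m hm; simp at hm

/-- `σ_c` applied to a monomial does not lower weights. -/
theorem wtGe_sigma_monomial (c : Matrix (Fin d) (Fin d) R) (m : Var d →₀ ℕ) (r : R) :
    WtGe (Finsupp.weight Var.wt m) (sigma c (monomial m r)) := by
  classical
  rw [MvPolynomial.monomial_eq, map_mul, sigma_C, Finsupp.prod, map_prod]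
  refine WtGe.C_mul ?_ r
  rw [Finsupp.weight_apply, Finsupp.sum]
  refine WtGe.prod _ fun u _ => ?_
  rw [map_pow, sigma_X, smul_eq_mul]
  exact (wtGe_sigmaX c u).pow _

/-- `σ_c f` has weights `≥ a` if `f` does. -/
theorem WtGe.sigma {a : ℕ} {f : MvPolynomial (Var d) R} (hf : WtGe a f) (c : Matrix (Fin d) (Fin d) R) :
    WtGe a (sigma c f) := by
  classical
  rw [f.as_sum, map_sum]
  refine WtGe.sum _ fun m hm => ?_
  exact (wtGe_sigma_monomial c m _).mono (hf m hm)

/-- `n_c` has all weights `≥ 1`. -/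
theorem wtGe_nvec (c : Matrix (Fin d) (Fin d) R) : WtGe 1 (nvec c) := by
  unfold nvec
  refine WtGe.sum _ fun u _ => ((wtGe_X u).C_mul _).mono u.one_le_wt

variable (d R)

/-- The truncation ideal `I_T`: spanned by the monomials of weight `> T`. -/
def truncIdeal (T : ℕ) : Ideal (MvPolynomial (Var d) R) :=
  Ideal.span ((fun m => monomial m (1 : R)) '' {m | T < Finsupp.weight Var.wt m})

variable {d R}

/-- Membership in the truncation ideal is a weight condition on the support. -/
theorem mem_truncIdeal_iff {T : ℕ} {f : MvPolynomial (Var d) R} :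
    f ∈ truncIdeal d R T ↔ WtGe (T + 1) f := by
  unfold truncIdeal
  rw [MvPolynomial.mem_ideal_span_monomial_image]
  constructor
  · intro h m hm
    obtain ⟨m', hm', hle⟩ := h m hm
    have : Finsupp.weight Var.wt m' ≤ Finsupp.weight Var.wt m := weight_le_of_le hle
    exact Nat.succ_le_of_lt (lt_of_lt_of_le hm' this)
  · intro h m hm
    exact ⟨m, h m hm, le_rfl⟩

/-- `σ_c` preserves the truncation ideal. -/
theorem sigma_mem_truncIdeal {T : ℕ} (c : Matrix (Fin d) (Fin d) R) {f : MvPolynomial (Var d) R}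
    (hf : f ∈ truncIdeal d R T) : sigma c f ∈ truncIdeal d R T :=
  mem_truncIdeal_iff.mpr ((mem_truncIdeal_iff.mp hf).sigma c)

/-- `σ_c` preserves the truncation ideal (comap form). -/
theorem truncIdeal_le_comap {T : ℕ} (c : Matrix (Fin d) (Fin d) R) :
    truncIdeal d R T ≤ (truncIdeal d R T).comap (sigma c) :=
  fun _ hf => sigma_mem_truncIdeal c hf

variable (d R)

/-- The truncated module `W_T = R[Var d] / I_T`. -/
abbrev TruncModel (T : ℕ) : Type _ := MvPolynomial (Var d) R ⧸ truncIdeal d R T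

variable {d R}

/-- The substitution endomorphism on the truncated module. -/
def sigmaQ (T : ℕ) (c : Matrix (Fin d) (Fin d) R) : TruncModel d R T →ₐ[R] TruncModel d R T :=
  Ideal.quotientMapₐ (truncIdeal d R T) (sigma c) (truncIdeal_le_comap c)

/-- `σ_c` on the truncated module, on representatives. -/
@[simp] theorem sigmaQ_mk (T : ℕ) (c : Matrix (Fin d) (Fin d) R) (f : MvPolynomial (Var d) R) :
    sigmaQ T c (Ideal.Quotient.mk _ f) = Ideal.Quotient.mk _ (sigma c f) := rfl

/-- Elements of positive weight are nilpotent in `W_T`: the `(T+1)`-st power vanishes. -/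
theorem pow_mk_eq_zero_of_wtGe {T : ℕ} {f : MvPolynomial (Var d) R} (hf : WtGe 1 f) {K : ℕ}
    (hK : T + 1 ≤ K) : (Ideal.Quotient.mk (truncIdeal d R T) f) ^ K = 0 := by
  rw [← map_pow, Ideal.Quotient.eq_zero_iff_mem, mem_truncIdeal_iff]
  have := hf.pow K
  rw [mul_one] at this
  exact this.mono hK

/-- Elements of positive weight are nilpotent in `W_T`. -/
theorem isNilpotent_mk_of_wtGe {T : ℕ} {f : MvPolynomial (Var d) R} (hf : WtGe 1 f) :
    IsNilpotent (Ideal.Quotient.mk (truncIdeal d R T) f) :=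
  ⟨T + 1, pow_mk_eq_zero_of_wtGe hf le_rfl⟩

/-- Landing hook of part 2: the substitution preserves the truncation ideal. -/
theorem stub_pm_truncIdeal : ∀ (d T : ℕ) (R : Type) [CommRing R] (c : Matrix (Fin d) (Fin d) R) (f : MvPolynomial (Var d) R), f ∈ truncIdeal d R T → sigma c f ∈ truncIdeal d R T :=
  fun _ _ _ _ c _ hf => sigma_mem_truncIdeal c hf

end Summit.MatrixMultiplication.MatrixMultiplication.Theorems.UnitriangularCostShape.ProductModel
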